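import Literature.MathematicalPhysics.QuantumFieldTheory.QuasiLocalGaugePerturbationCells
import Literature.Probability.LatticeModels.CoarseCellMixingDefectsBlockLeak
import HarnessLib

/-!
# Quasi-local gauge-invariant perturbations, VII: block quasi-locality of the DLR kernels through cells

Seventh file on the tree's `QuasiLocalGaugePerturbation d N G b`, companion of
`QuasiLocalGaugePerturbationCells.lean`. There the quasi-locality of the DLR kernels of the
perturbed torus measure `μ_{β,W}` in the exterior (`…Kernels.integral_kernel_le_exp_mul_of_exterior_eq`)
was read through cells only for CENTRAL-cell observables of window cubes (`hasLeak_kernel_of_card_le`,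
the `HasLeak` profile of `CoarseCellFiniteSize`). The same source lemma is a statement about
ARBITRARY link sets and arbitrary observables reading them, i.e. exactly the ratio-form block
quasi-locality `HasBlockLeak` of `CoarseCellMixingDefectsBlockLeak` (the datum a cluster expansion
around Peierls-rare bad cells consumes):

* `hasBlockLeak_kernel_of_card_le` — if every cell meets at most `K` blocks and cells contract
  block nearness, then under `‖W‖_{b,κ} ≤ η` (`κ ≥ 0`), range control and `b ≥ 1` the kernels of `W`
  satisfy `HasBlockLeak cell (W.kernel ρ β) (4 η K) κ`; Wilson's kernels (`W = 0`) satisfy it with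
  amplitude `0` (`hasBlockLeak_kernel_zero`).

Sources: Georgii, *Gibbs Measures and Phase Transitions* (2011), Ch. 8; Dobrushin–Shlosman (1987)
(complete analyticity conditions on arbitrary volumes). Folklore-level corollaries of `…Kernels`.
-/

noncomputable section

open MeasureTheory
open Literature.Probability.LatticeModels (CoarseIdx cdist cellCount HasBlockLeak)
open Literature.MathematicalPhysics.QuantumLattice

namespace Literature.MathematicalPhysics.QuantumFieldTheory

section Kernels

namespace QuasiLocalGaugePerturbation

variable {G : Type*} [Group G] [TopologicalSpace G] [IsTopologicalGroup G] [CompactSpace G]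
  [MeasurableSpace G] [BorelSpace G] {Nρ : ℕ} (ρ : G →* Matrix (Fin Nρ) (Fin Nρ) ℂ) {d N : ℕ}
  [NeZero N] {b : ℕ} {μc : Fin d → ℕ}

variable [SecondCountableTopology G] (hρ : Continuous ρ)
include hρ

/-- **Block quasi-locality of the perturbed kernels, through cells**: if every link set `A` meets at
most `K · cellCount A` blocks and cells contract block nearness (links whose
blocks are `(2D+1)`-near lie at coarse distance `≤ D + 1`), then under `‖W‖_{b,κ} ≤ η` (`κ ≥ 0`),
range control and `b ≥ 1`, for EVERY cell-union `A`, exteriors agreeing on the links whose cell is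
within `D + 1` of a cell of `A`, and every `[0,1]`-valued measurable `f` reading `A` and agreeing
links, `γ_A f(ζ) ≤ exp(4 η K · cellCount A · e^{-κD}) γ_A f(ζ')` — quasi-locality in the exterior
(`…Kernels.integral_kernel_le_exp_mul_of_exterior_eq`) with `m = 2D` blocks and `e^{-2κD} ≤ e^{-κD}`.
[cite: Georgii2011, Ch. 8] -/
theorem hasBlockLeak_kernel_of_card_le [MeasurableSingletonClass G] (hb : 1 ≤ b)
    (cell : Edge d N → CoarseIdx μc) {K : ℝ}
    (hK : ∀ A : Finset (Edge d N),
      ((A.image fun e => blockCorner b e.1).card : ℝ) ≤ K * cellCount cell A)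
    (hcon : ∀ (D : ℕ) (e e' : Edge d N),
      (∀ i, (blockCorner b e'.1 i - blockCorner b e.1 i).val ≤ b * (2 * D + 1) ∨
        (blockCorner b e.1 i - blockCorner b e'.1 i).val ≤ b * (2 * D + 1)) →
      cdist (cell e') (cell e) ≤ D + 1)
    (β : ℝ) {κ η : ℝ} (hκ : 0 ≤ κ) (W : QuasiLocalGaugePerturbation d N G b)
    (hW : W.NormLE κ η)
    (hRC : ∀ X : Finset (Site d N), X ∈ polymers b → (∃ U : GaugeConfig d N G, W.act X U ≠ 0) →
      ∀ y ∈ X, ∀ y' ∈ X, ∀ i : Fin d, (y i - y' i).val ≤ b * X.card ∨ (y' i - y i).val ≤ b * X.card) :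
    HasBlockLeak cell (W.kernel ρ β) (4 * η * K) κ := by
  intro A _ D ζ ζ' hagree f hf hf01 hdep
  have hη : 0 ≤ η := hW.nonneg
  set R := A.image fun e => blockCorner b e.1 with hRdef
  have hR : R ⊆ blockCorners b := fun y hy => by
    obtain ⟨e, -, rfl⟩ := Finset.mem_image.1 hy
    exact mem_blockCorners_iff.2 (isBlockAligned_blockCorner b e.1)
  have hΛ : ∀ e ∈ A, blockCorner b e.1 ∈ R := fun e he => Finset.mem_image_of_mem _ he
  -- links `(2D+1)`-near the blocks of `A` lie in cells within `D+1` of a cell of `A`, hence agree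
  have hζ : ∀ e : Edge d N, (∃ y ∈ R, ∀ i, (y i - blockCorner b e.1 i).val ≤ b * (2 * D + 1) ∨
      (blockCorner b e.1 i - y i).val ≤ b * (2 * D + 1)) → ζ e = ζ' e := by
    rintro e ⟨y, hy, hnear⟩
    obtain ⟨e', he', rfl⟩ := Finset.mem_image.1 hy
    exact hagree e ⟨e', he', hcon D e e' hnear⟩
  have h := integral_kernel_le_exp_mul_of_exterior_eq ρ hρ hb β W hκ hW hRC hR hΛ (2 * D) hζ hf
    hf01 hdep
  refine h.trans (mul_le_mul_of_nonneg_right (Real.exp_le_exp.2 ?_)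
    (integral_nonneg fun U => (hf01 U).1))
  have htD : Real.exp (-(κ * ((2 * D : ℕ) : ℝ))) ≤ Real.exp (-(κ * D)) := by
    refine Real.exp_le_exp.2 (neg_le_neg (mul_le_mul_of_nonneg_left ?_ hκ))
    exact_mod_cast (by omega : D ≤ 2 * D)
  calc 4 * (η * Real.exp (-(κ * ((2 * D : ℕ) : ℝ)))) * (R.card : ℝ)
      ≤ 4 * (η * Real.exp (-(κ * D))) * (K * cellCount cell A) :=
        mul_le_mul (mul_le_mul_of_nonneg_left (mul_le_mul_of_nonneg_left htD hη) (by norm_num))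
          (hK A) (Nat.cast_nonneg _) (by positivity)
    _ = 4 * η * K * cellCount cell A * Real.exp (-(κ * D)) := by ring

/-- **Wilson's kernels are block-Markov at the cell scale**: `HasBlockLeak` with amplitude `0`
(the case `W = 0`, `η = 0`; exteriors agreeing `1`-near the block give identical expectations of
block-local observables). [folklore] -/
theorem hasBlockLeak_kernel_zero [MeasurableSingletonClass G] (hb : 1 ≤ b)
    (cell : Edge d N → CoarseIdx μc) {K : ℝ}
    (hK : ∀ A : Finset (Edge d N),
      ((A.image fun e => blockCorner b e.1).card : ℝ) ≤ K * cellCount cell A)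
    (hcon : ∀ (D : ℕ) (e e' : Edge d N),
      (∀ i, (blockCorner b e'.1 i - blockCorner b e.1 i).val ≤ b * (2 * D + 1) ∨
        (blockCorner b e.1 i - blockCorner b e'.1 i).val ≤ b * (2 * D + 1)) →
      cdist (cell e') (cell e) ≤ D + 1)
    (β : ℝ) {κ : ℝ} (hκ : 0 ≤ κ) :
    HasBlockLeak cell ((0 : QuasiLocalGaugePerturbation d N G 1).kernel ρ β) 0 κ := by
  have h0 := hasBlockLeak_kernel_of_card_le ρ hρ hb cell hK hcon β hκ
    (0 : QuasiLocalGaugePerturbation d N G b) (normLE_zero le_rfl)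
    (fun X _ hU => by obtain ⟨U, hU⟩ := hU; exact absurd (zero_act X U) hU)
  rw [kernel_zero_eq ρ β b 1] at h0
  simpa using h0

end QuasiLocalGaugePerturbation

end Kernels

end Literature.MathematicalPhysics.QuantumFieldTheory
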